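import Summits.Ventures.QEC.CircuitDistance.DEMCheckSound
import Summits.Ventures.QEC.CircuitDistance.SMSchedule
import HarnessLib

/-!
# Word-level checker for an ARBITRARY event list (`Gen.*`) and its soundness — the `DEMCheck`/`DEMCheckSound` layer of record,
# re-pointed from `allEvents Nc` to `es : List Ev` (venture QEC, experiment cell CDX, Q4 lane; nothing here asserts a value of `d_circ`)

Provenance: drafted by qec-cdx-idea-2 g2 (2026-08-28, director-qec R156 (4)), typed by qec-cdx-type-2, statement audit qec-cdx-crit-1.
Imports `DEMCheckSound` + `SMSchedule`; no landed declaration is edited.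

WHAT THIS FILE DOES. `DEMCheck.lean` evaluates the effect of a fault by 𝔽₂-WORD arithmetic (`simulateW`, generic in the event list
already) but packages it for print's cycle only: `runW S Nc f := simulateW S f (allEvents Nc) WState.init`, `effectWs`,
`undetectableW`, `logicalErrorW`; `DEMCheckSound.lean` proves the WITNESS PRINCIPLE `hasLogicalFault_of_checks` for that packaging.
Here the same four definitions and the same soundness chain are re-stated over an arbitrary `es : List Ev` — bodies copied, with
`allEvents Nc ↦ es` and `rel_run S Nc f ↦ Rel.init.simulate S f es` (the relational lemma `Rel.simulate` of `DEMCheckRel.lean` is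
generic in the event list) — each with the `rfl` ANCHOR that at `es = allEvents Nc` it is the landed notion, ending in
* `Gen.hasLogicalFault_of_checks S Nc es L … : Gen.HasLogicalFaultOfWeightAtMostAt S Nc es L.length`, and its schedule form
* `hasLogicalFaultAtₛ_of_checks σ S Nc L … : HasLogicalFaultOfWeightAtMostAtₛ σ S Nc L.length`
(so an explicit fault list for ANY of the 936 CNOT orders is certified by ONE `decide +kernel`, exactly as `Witnesses.lean` does for
print's order). All word conventions (`bitIdx`, `translateW`, `synXW/synZW`, `oddOverlap`, `vecOfWords`) are DEMCheck's, reused by name.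
-/

namespace Summit.Ventures.QEC.CircuitDistance

open Literature.InformationTheory.QuantumCodes

variable {ℓ m : ℕ}

section
variable [NeZero ℓ] [NeZero m]

namespace Gen

/-! ## The four word-level notions over an arbitrary event list -/

/-- Word-level effect of the single fault `f` when the circuit is the event list `es` (cf. `runW`). -/
def runW (S : SMCode ℓ m) (es : List Ev) (f : Fault ℓ m) : WState := simulateW S f es WState.init

/-- Summed effect of a fault list (cf. `effectWs`). -/
def effectWs (S : SMCode ℓ m) (es : List Ev) (F : List (Fault ℓ m)) : WEffect :=
  F.foldr (fun f acc => (Gen.runW S es f).effect.add acc) WEffect.zero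

/-- Word-level UNDETECTABILITY check in the `Nc`-cycle circuit with event list `es` (cf. `undetectableW`): every fault sits on
an event of `es`, every detector word of layers `0 … Nc+1` vanishes, and no outcome of the (nonexistent) cycle `0` is flipped. -/
def undetectableW (S : SMCode ℓ m) (Nc : ℕ) (es : List Ev) (F : List (Fault ℓ m)) : Bool :=
  F.all (fun f => es.contains f.ev) &&
    (List.range (Nc + 2)).all (fun t => (Gen.effectWs S es F).detX S Nc t == 0 && (Gen.effectWs S es F).detZ S Nc t == 0) &&
    ((Gen.effectWs S es F).mX 0 == 0) && ((Gen.effectWs S es F).mZ 0 == 0)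

/-- Word-level LOGICAL-ERROR check (cf. `logicalErrorW`): `sector = true`: `X`-type residual vs a `Z`-type witness `u = (uL,uR)`
with `H^X u = 0` and odd overlap; `sector = false`: `Z`-type residual vs an `X`-type witness with `H^Z u = 0`. -/
def logicalErrorW (S : SMCode ℓ m) (es : List Ev) (F : List (Fault ℓ m)) (sector : Bool) (uL uR : ℕ) : Bool :=
  let E := Gen.effectWs S es F
  if sector then synXW S uL uR == 0 && oddOverlap (ℓ * m) uL uR E.xL E.xR
  else synZW S uL uR == 0 && oddOverlap (ℓ * m) uL uR E.zL E.zR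

/-! ### Anchors: at `es = allEvents Nc` these ARE the landed notions (all `rfl`). -/

/-- Anchor: `Gen.runW` at `allEvents Nc` is `runW`. -/
theorem runW_allEvents (S : SMCode ℓ m) (Nc : ℕ) : Gen.runW S (allEvents Nc) = CircuitDistance.runW S Nc := rfl

/-- Anchor: `Gen.effectWs` at `allEvents Nc` is `effectWs`. -/
theorem effectWs_allEvents (S : SMCode ℓ m) (Nc : ℕ) : Gen.effectWs S (allEvents Nc) = CircuitDistance.effectWs S Nc := rfl

/-- Anchor: `Gen.undetectableW` at `allEvents Nc` is `undetectableW`. -/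
theorem undetectableW_allEvents (S : SMCode ℓ m) (Nc : ℕ) :
    Gen.undetectableW S Nc (allEvents Nc) = CircuitDistance.undetectableW S Nc := rfl

/-- Anchor: `Gen.logicalErrorW` at `allEvents Nc` is `logicalErrorW`. -/
theorem logicalErrorW_allEvents (S : SMCode ℓ m) (Nc : ℕ) :
    Gen.logicalErrorW S (allEvents Nc) = CircuitDistance.logicalErrorW S Nc := rfl

/-! ## Soundness chain (the proofs of `DEMCheckSound.lean`, with `rel_run S Nc f ↦ Rel.init.simulate S f es`) -/

/-- The bit semantics IS the word semantics, for any event list (cf. `rel_run`). -/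
theorem rel_runW (S : SMCode ℓ m) (es : List Ev) (f : Fault ℓ m) : Rel (Gen.run1 S es f) (Gen.runW S es f) :=
  Rel.init.simulate S f es

/-- Bits of the summed `X`-flip words = `Gen.flipX` of the `Finset`. -/
theorem testBit_effectWs_mX (S : SMCode ℓ m) (es : List Ev) (L : List (Fault ℓ m)) (hL : L.Nodup) (c : ℕ) (i : BB.Mono ℓ m) :
    ((Gen.effectWs S es L).mX c).testBit (bitIdx i) = Gen.flipX S es L.toFinset c i := by
  unfold Gen.flipX
  rw [bsum_toFinset L hL]
  clear hL
  induction L with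
  | nil => simp [Gen.effectWs, WEffect.zero]
  | cons a L ih =>
    simp only [Gen.effectWs, List.foldr_cons, WEffect.add, WState.effect, Nat.testBit_xor] at ih ⊢
    rw [ih, (Gen.rel_runW S es a).hX c i]

/-- Bits of the summed `Z`-flip words = `Gen.flipZ` of the `Finset`. -/
theorem testBit_effectWs_mZ (S : SMCode ℓ m) (es : List Ev) (L : List (Fault ℓ m)) (hL : L.Nodup) (c : ℕ) (i : BB.Mono ℓ m) :
    ((Gen.effectWs S es L).mZ c).testBit (bitIdx i) = Gen.flipZ S es L.toFinset c i := by
  unfold Gen.flipZ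
  rw [bsum_toFinset L hL]
  clear hL
  induction L with
  | nil => simp [Gen.effectWs, WEffect.zero]
  | cons a L ih =>
    simp only [Gen.effectWs, List.foldr_cons, WEffect.add, WState.effect, Nat.testBit_xor] at ih ⊢
    rw [ih, (Gen.rel_runW S es a).hZ c i]

/-- Generic: bits of an XOR-folded word family vs the XOR-fold of bits. -/
theorem testBit_foldr_effect (S : SMCode ℓ m) (es : List Ev) (L : List (Fault ℓ m)) (sel : WEffect → ℕ) (g : Fault ℓ m → Bool)
    (hsel_zero : sel WEffect.zero = 0) (hsel_add : ∀ a b, sel (a.add b) = sel a ^^^ sel b) (j : ℕ)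
    (hg : ∀ f, (sel (Gen.runW S es f).effect).testBit j = g f) :
    (sel (Gen.effectWs S es L)).testBit j = L.foldr (fun f b => xor (g f) b) false := by
  induction L with
  | nil => simp [Gen.effectWs, hsel_zero]
  | cons a L ih =>
    unfold Gen.effectWs at ih ⊢
    rw [List.foldr_cons, hsel_add, Nat.testBit_xor, hg a, ih, List.foldr_cons]

/-- Bits of the summed residual `x`-word on `q(L)`. -/
theorem testBit_effectWs_xL (S : SMCode ℓ m) (es : List Ev) (L : List (Fault ℓ m)) (hL : L.Nodup) (i : BB.Mono ℓ m) :
    ((Gen.effectWs S es L).xL).testBit (bitIdx i) = bsum L.toFinset (fun f => ((Gen.run1 S es f).frame (Reg.L, i)).1) := by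
  rw [bsum_toFinset L hL]
  exact Gen.testBit_foldr_effect S es L WEffect.xL _ rfl (fun _ _ => rfl) _ (fun f => ((Gen.rel_runW S es f).fx Reg.L i).symm)

/-- Bits of the summed residual `x`-word on `q(R)`. -/
theorem testBit_effectWs_xR (S : SMCode ℓ m) (es : List Ev) (L : List (Fault ℓ m)) (hL : L.Nodup) (i : BB.Mono ℓ m) :
    ((Gen.effectWs S es L).xR).testBit (bitIdx i) = bsum L.toFinset (fun f => ((Gen.run1 S es f).frame (Reg.R, i)).1) := by
  rw [bsum_toFinset L hL]
  exact Gen.testBit_foldr_effect S es L WEffect.xR _ rfl (fun _ _ => rfl) _ (fun f => ((Gen.rel_runW S es f).fx Reg.R i).symm)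

/-- Bits of the summed residual `z`-word on `q(L)`. -/
theorem testBit_effectWs_zL (S : SMCode ℓ m) (es : List Ev) (L : List (Fault ℓ m)) (hL : L.Nodup) (i : BB.Mono ℓ m) :
    ((Gen.effectWs S es L).zL).testBit (bitIdx i) = bsum L.toFinset (fun f => ((Gen.run1 S es f).frame (Reg.L, i)).2) := by
  rw [bsum_toFinset L hL]
  exact Gen.testBit_foldr_effect S es L WEffect.zL _ rfl (fun _ _ => rfl) _ (fun f => ((Gen.rel_runW S es f).fz Reg.L i).symm)

/-- Bits of the summed residual `z`-word on `q(R)`. -/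
theorem testBit_effectWs_zR (S : SMCode ℓ m) (es : List Ev) (L : List (Fault ℓ m)) (hL : L.Nodup) (i : BB.Mono ℓ m) :
    ((Gen.effectWs S es L).zR).testBit (bitIdx i) = bsum L.toFinset (fun f => ((Gen.run1 S es f).frame (Reg.R, i)).2) := by
  rw [bsum_toFinset L hL]
  exact Gen.testBit_foldr_effect S es L WEffect.zR _ rfl (fun _ _ => rfl) _ (fun f => ((Gen.rel_runW S es f).fz Reg.R i).symm)

/-- `Gen.dataX` on the left block, as a Boolean. -/
theorem dataX_inl (S : SMCode ℓ m) (es : List Ev) (F : Finset (Fault ℓ m)) (i : BB.Mono ℓ m) :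
    Gen.dataX S es F (Sum.inl i) = if bsum F (fun f => ((Gen.run1 S es f).frame (Reg.L, i)).1) then 1 else 0 := rfl
/-- `Gen.dataX` on the right block. -/
theorem dataX_inr (S : SMCode ℓ m) (es : List Ev) (F : Finset (Fault ℓ m)) (i : BB.Mono ℓ m) :
    Gen.dataX S es F (Sum.inr i) = if bsum F (fun f => ((Gen.run1 S es f).frame (Reg.R, i)).1) then 1 else 0 := rfl
/-- `Gen.dataZ` on the left block. -/
theorem dataZ_inl (S : SMCode ℓ m) (es : List Ev) (F : Finset (Fault ℓ m)) (i : BB.Mono ℓ m) :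
    Gen.dataZ S es F (Sum.inl i) = if bsum F (fun f => ((Gen.run1 S es f).frame (Reg.L, i)).2) then 1 else 0 := rfl
/-- `Gen.dataZ` on the right block. -/
theorem dataZ_inr (S : SMCode ℓ m) (es : List Ev) (F : Finset (Fault ℓ m)) (i : BB.Mono ℓ m) :
    Gen.dataZ S es F (Sum.inr i) = if bsum F (fun f => ((Gen.run1 S es f).frame (Reg.R, i)).2) then 1 else 0 := rfl

/-- The final TRUE syndrome of the residual `Z`-error, bitwise: `(H^X β)_i = 1` iff bit `i` of `synXW`. -/
theorem decide_HX_dataZ (S : SMCode ℓ m) (es : List Ev) (L : List (Fault ℓ m)) (hL : L.Nodup) (i : BB.Mono ℓ m) :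
    decide ((S.toCode.HX.mulVec (Gen.dataZ S es L.toFinset)) i = 1) =
      (synXW S (Gen.effectWs S es L).zL (Gen.effectWs S es L).zR).testBit (bitIdx i) := by
  rw [HX_mulVec_apply, testBit_synXW]
  simp only [Gen.dataZ_inl, Gen.dataZ_inr, Gen.testBit_effectWs_zL S es L hL, Gen.testBit_effectWs_zR S es L hL]
  exact ite_sum6_eq_one_iff _ _ _ _ _ _

/-- The final TRUE syndrome of the residual `X`-error, bitwise. -/
theorem decide_HZ_dataX (S : SMCode ℓ m) (es : List Ev) (L : List (Fault ℓ m)) (hL : L.Nodup) (i : BB.Mono ℓ m) :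
    decide ((S.toCode.HZ.mulVec (Gen.dataX S es L.toFinset)) i = 1) =
      (synZW S (Gen.effectWs S es L).xL (Gen.effectWs S es L).xR).testBit (bitIdx i) := by
  rw [HZ_mulVec_apply, testBit_synZW]
  simp only [Gen.dataX_inl, Gen.dataX_inr, Gen.testBit_effectWs_xL S es L hL, Gen.testBit_effectWs_xR S es L hL]
  exact ite_sum6_eq_one_iff _ _ _ _ _ _

/-- DETECTOR BRIDGE (`X`-checks): the `Finset` detector equals the bit of the detector word. -/
theorem detX_eq_testBit (S : SMCode ℓ m) (Nc : ℕ) (es : List Ev) (L : List (Fault ℓ m)) (hL : L.Nodup) (t : ℕ)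
    (i : BB.Mono ℓ m) :
    Gen.detX S Nc es L.toFinset t i = ((Gen.effectWs S es L).detX S Nc t).testBit (bitIdx i) := by
  unfold Gen.detX WEffect.detX
  by_cases h0 : t = 0
  · simp [h0]
  rw [if_neg h0, if_neg h0]
  by_cases h1 : t ≤ Nc
  · rw [if_pos h1, if_pos h1, Nat.testBit_xor, Gen.testBit_effectWs_mX S es L hL, Gen.testBit_effectWs_mX S es L hL]
  rw [if_neg h1, if_neg h1]
  by_cases h2 : t = Nc + 1
  · rw [if_pos h2, if_pos h2, Nat.testBit_xor, Gen.decide_HX_dataZ S es L hL, Gen.testBit_effectWs_mX S es L hL]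
  · rw [if_neg h2, if_neg h2]; simp

/-- DETECTOR BRIDGE (`Z`-checks). -/
theorem detZ_eq_testBit (S : SMCode ℓ m) (Nc : ℕ) (es : List Ev) (L : List (Fault ℓ m)) (hL : L.Nodup) (t : ℕ)
    (i : BB.Mono ℓ m) :
    Gen.detZ S Nc es L.toFinset t i = ((Gen.effectWs S es L).detZ S Nc t).testBit (bitIdx i) := by
  unfold Gen.detZ WEffect.detZ
  by_cases h0 : t = 0
  · simp [h0]
  rw [if_neg h0, if_neg h0]
  by_cases h1 : t ≤ Nc
  · rw [if_pos h1, if_pos h1, Nat.testBit_xor, Gen.testBit_effectWs_mZ S es L hL, Gen.testBit_effectWs_mZ S es L hL]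
  rw [if_neg h1, if_neg h1]
  by_cases h2 : t = Nc + 1
  · rw [if_pos h2, if_pos h2, Nat.testBit_xor, Gen.decide_HZ_dataX S es L hL, Gen.testBit_effectWs_mZ S es L hL]
  · rw [if_neg h2, if_neg h2]; simp

/-- **SOUNDNESS OF THE UNDETECTABILITY CHECK** (cf. `undetectable_of_undetectableW`). -/
theorem undetectable_of_undetectableW (S : SMCode ℓ m) (Nc : ℕ) (es : List Ev) (L : List (Fault ℓ m)) (hL : L.Nodup)
    (h : Gen.undetectableW S Nc es L = true) : Gen.Undetectable S Nc es L.toFinset := by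
  unfold Gen.undetectableW at h
  simp only [Bool.and_eq_true, List.all_eq_true, beq_iff_eq] at h
  obtain ⟨⟨⟨hev, hdet⟩, _⟩, _⟩ := h
  refine ⟨?_, ?_⟩
  · intro f hf
    have := hev f (List.mem_toFinset.1 hf)
    simpa using this
  · intro t i
    by_cases ht : t ≤ Nc + 1
    · obtain ⟨hx, hz⟩ := hdet t (List.mem_range.2 (by omega))
      rw [Gen.detX_eq_testBit S Nc es L hL, Gen.detZ_eq_testBit S Nc es L hL, hx, hz]
      simp
    · have h0 : t ≠ 0 := by omega
      have h1 : ¬ t ≤ Nc := by omega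
      have h2 : t ≠ Nc + 1 := by omega
      simp [Gen.detX, Gen.detZ, h0, h1, h2]

/-- **SOUNDNESS OF THE LOGICAL-ERROR CHECK** (cf. `logicalError_of_logicalErrorW`). -/
theorem logicalError_of_logicalErrorW (S : SMCode ℓ m) (es : List Ev) (L : List (Fault ℓ m)) (hL : L.Nodup)
    (sector : Bool) (uL uR : ℕ) (h : Gen.logicalErrorW S es L sector uL uR = true) : Gen.LogicalError S es L.toFinset := by
  unfold Gen.logicalErrorW at h
  unfold Gen.LogicalError
  cases sector with
  | true =>
    simp only [↓reduceIte, Bool.and_eq_true, beq_iff_eq] at h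
    obtain ⟨hsyn, hodd⟩ := h
    intro hmem
    have hu := HX_mulVec_vecOfWords_eq_zero S uL uR hsyn
    have hdot : dotProduct (vecOfWords uL uR) (Gen.dataX S es L.toFinset) ≠ 0 := by
      rw [vecOfWords_dotProduct uL uR (Gen.effectWs S es L).xL (Gen.effectWs S es L).xR]
      · rw [hodd]; decide
      · intro i; rw [Gen.dataX_inl, ← Gen.testBit_effectWs_xL S es L hL]
      · intro i; rw [Gen.dataX_inr, ← Gen.testBit_effectWs_xR S es L hL]
    exact not_mem_rowSpace_of_witness (vecOfWords uL uR) hu hdot hmem.1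
  | false =>
    simp only [Bool.false_eq_true, ↓reduceIte, Bool.and_eq_true, beq_iff_eq] at h
    obtain ⟨hsyn, hodd⟩ := h
    intro hmem
    have hu := HZ_mulVec_vecOfWords_eq_zero S uL uR hsyn
    have hdot : dotProduct (vecOfWords uL uR) (Gen.dataZ S es L.toFinset) ≠ 0 := by
      rw [vecOfWords_dotProduct uL uR (Gen.effectWs S es L).zL (Gen.effectWs S es L).zR]
      · rw [hodd]; decide
      · intro i; rw [Gen.dataZ_inl, ← Gen.testBit_effectWs_zL S es L hL]
      · intro i; rw [Gen.dataZ_inr, ← Gen.testBit_effectWs_zR S es L hL]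
    exact not_mem_rowSpace_of_witness (vecOfWords uL uR) hu hdot hmem.2

/-- **WITNESS PRINCIPLE, any event list** (cf. `hasLogicalFault_of_checks`): a duplicate-free fault list accepted by both
word-level checks realises an undetectable logical fault set of `faultCount ≤ L.length` in the `Nc`-cycle circuit `es`. -/
theorem hasLogicalFault_of_checks (S : SMCode ℓ m) (Nc : ℕ) (es : List Ev) (L : List (Fault ℓ m)) (hL : L.Nodup)
    (sector : Bool) (uL uR : ℕ) (hund : Gen.undetectableW S Nc es L = true)
    (hlog : Gen.logicalErrorW S es L sector uL uR = true) :
    Gen.HasLogicalFaultOfWeightAtMostAt S Nc es L.length := by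
  refine ⟨L.toFinset, Gen.undetectable_of_undetectableW S Nc es L hL hund,
    Gen.logicalError_of_logicalErrorW S es L hL sector uL uR hlog, ?_⟩
  unfold faultCount
  calc (L.toFinset.image Fault.loc).card ≤ L.toFinset.card := Finset.card_image_le
    _ ≤ L.length := List.toFinset_card_le L

/-- … and the `sInf` consequence `Gen.circuitDistance ≤ L.length`. -/
theorem circuitDistance_le_of_hasAt (S : SMCode ℓ m) (Nc : ℕ) (es : List Ev) (w : ℕ)
    (h : Gen.HasLogicalFaultOfWeightAtMostAt S Nc es w) : Gen.circuitDistance S Nc es ≤ w := by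
  obtain ⟨F, hU, hL, hc⟩ := h
  exact le_trans (Nat.sInf_le ⟨F, hU, hL, rfl⟩) hc

end Gen

/-! ## Schedule form -/

/-- **WITNESS PRINCIPLE for a CNOT order `σ`**: an explicit duplicate-free fault list accepted by the two word-level checks run on
`allEventsₛ σ Nc` proves `HasLogicalFaultOfWeightAtMostAtₛ σ S Nc L.length` (one `decide +kernel` per check). -/
theorem hasLogicalFaultAtₛ_of_checks (σ : SMSchedule) (S : SMCode ℓ m) (Nc : ℕ) (L : List (Fault ℓ m)) (hL : L.Nodup)
    (sector : Bool) (uL uR : ℕ) (hund : Gen.undetectableW S Nc (allEventsₛ σ Nc) L = true)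
    (hlog : Gen.logicalErrorW S (allEventsₛ σ Nc) L sector uL uR = true) :
    HasLogicalFaultOfWeightAtMostAtₛ σ S Nc L.length :=
  Gen.hasLogicalFault_of_checks S Nc (allEventsₛ σ Nc) L hL sector uL uR hund hlog

/-- `circuitDistanceₛ σ S Nc ≤ w` from a weight-`≤ w` set at `Nc`. -/
theorem circuitDistanceₛ_le_of_hasAt (σ : SMSchedule) (S : SMCode ℓ m) (Nc w : ℕ)
    (h : HasLogicalFaultOfWeightAtMostAtₛ σ S Nc w) : circuitDistanceₛ σ S Nc ≤ w :=
  Gen.circuitDistance_le_of_hasAt S Nc (allEventsₛ σ Nc) w h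

end

end Summit.Ventures.QEC.CircuitDistance
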